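import Literature.Algebra.Bialgebra.DegreeTwoSpannedByDegreeOne
import Literature.Algebra.Bialgebra.NoPrimitiveInDegreeTwo

/-!
# `H¹ ∪ H¹ = H²` for a connected graded-commutative bialgebra with Künneth decomposition (char 0)

The assembly of [cite: MumfordAV1970, §13 Cor. 2 (p. 129)] ∕ [cite: MilnorMoore1965, §4 Prop. 4.17, 4.20] in degree
two, from AXIOMS ON COHOMOLOGY CLASSES only.  Data: graded pieces `HA n = Ȟⁿ(A)` and `HS n = Ȟⁿ(A × A)` of two
graded-commutative unital `k`-algebras (cup products `cupA`, `cupS` with their target degree as data), degree-preserving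
maps `m, p₁, p₂ : HA → HS` («`m^*, p₁^*, p₂^*`»), `i₁, i₂ : HS → HA` («slices `(id,0)^*, (0,id)^*`»), `sw : HS → HS`
(«swap»), units `oneA, oneS` and the augmentation `aug : HA 0 → k` («`Ȟ⁰(A) = k`», connectedness).  Axioms: all maps
multiplicative and unital; the composites `i₁ ∘ m = i₂ ∘ m = i₁ ∘ p₁ = i₂ ∘ p₂ = id`, `i₁ ∘ p₂ = i₂ ∘ p₁ = 0` in positive
degree, `sw ∘ m = m`, `sw ∘ p₁ = p₂`, `sw ∘ p₂ = p₁`; `HS` graded-commutative and associative; KÜNNETH: the classes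
`p₁^*y ∪ p₂^*z` decompose `HS n` as `⊕_{a+b=n} HA a ⊗ HA b` (injectivity on families with distinct bidegrees,
surjectivity in antidiagonal form); BOUNDED grading; `char k = 0`.  Conclusion (`cup_one_one_surjective`): **the cup
product `HA 1 ⊗ HA 1 → HA 2` is onto.**  Route: the degree-`1` and degree-`2` Künneth decompositions of `m^*`
(`m^*a = p₁^*a + p₂^*a`, `m^*x = p₁^*x + κ(μ x) + p₂^*x`), the three hypotheses (h1) (h2) (h3) of
`DegreeTwoSpannedByDegreeOne` (the last one through the power argument `NoPrimitiveInDegreeTwo` on even pieces), and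
`cup_surjective`.  Pure linear algebra, no definition; the geometric instantiation (ordered Čech cohomology of an abelian
variety, pull-backs, Künneth, diagonal trick) is done elsewhere.
-/

namespace Literature.Algebra.Bialgebra

open TensorProduct Finset

universe u v w

section Assembly

variable {k : Type u} [Field k]
  {HA : ℕ → Type v} [∀ i, AddCommGroup (HA i)] [∀ i, Module k (HA i)]
  {HS : ℕ → Type w} [∀ i, AddCommGroup (HS i)] [∀ i, Module k (HS i)]
  {cupA : ∀ a b n : ℕ, a + b = n → HA a →ₗ[k] HA b →ₗ[k] HA n}
  {cupS : ∀ a b n : ℕ, a + b = n → HS a →ₗ[k] HS b →ₗ[k] HS n}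
  {m p₁ p₂ : ∀ n : ℕ, HA n →ₗ[k] HS n} {i₁ i₂ : ∀ n : ℕ, HS n →ₗ[k] HA n} {sw : ∀ n : ℕ, HS n →ₗ[k] HS n}
  {oneA : HA 0} {oneS : HS 0} {aug : HA 0 →ₗ[k] k}

/-! ### Graded-commutative bookkeeping in `HS` -/

/-- **Interchange law with an even middle pair**: in a graded-commutative associative algebra,
`(Y ∪ Z) ∪ (Y' ∪ Z') = (Y ∪ Y') ∪ (Z ∪ Z')` whenever `deg Z · deg Y'` is even (all degrees carried as data).
[cite: MumfordAV1970, §13 Cor. 2 (p. 129), proof] -/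
theorem cup_interchange_of_even
    (hassoc : ∀ (a b c ab bc n : ℕ) (hab : a + b = ab) (hbc : b + c = bc) (h : ab + c = n)
      (y : HS a) (z : HS b) (w : HS c),
      cupS ab c n h (cupS a b ab hab y z) w = cupS a bc n (by omega) y (cupS b c bc hbc z w))
    (hcomm : ∀ (a b n : ℕ) (h : a + b = n) (y : HS a) (z : HS b),
      cupS a b n h y z = ((-1 : k) ^ (a * b)) • cupS b a n (by omega) z y)
    (a b a' b' n n' N A B : ℕ) (hn : a + b = n) (hn' : a' + b' = n') (hN : n + n' = N) (hA : a + a' = A)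
    (hB : b + b' = B) (heven : Even (b * a')) (Y : HS a) (Z : HS b) (Y' : HS a') (Z' : HS b') :
    cupS n n' N hN (cupS a b n hn Y Z) (cupS a' b' n' hn' Y' Z') =
      cupS A B N (by omega) (cupS a a' A hA Y Y') (cupS b b' B hB Z Z') := by
  rw [hassoc a b n' n (b + n') N hn (by omega) hN, ← hassoc b a' b' (b + a') n' (b + n') rfl hn' (by omega),
    hcomm b a' (b + a') rfl Z Y', heven.neg_one_pow, one_smul,
    hassoc a' b b' (b + a') B (b + n') (by omega) hB (by omega),
    ← hassoc a a' B A (b + n') N hA (by omega) (by omega)]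

/-! ### Contracting the degree-`0` Künneth factors (connectedness `Ȟ⁰(A) = k · 1`) -/

/-- `p₁^*y ∪ p₂^*z = p₁^*(aug z • y)` for `z` of degree `0`: the `(a,0)` Künneth component is `p₁^*` of the
contraction `y ⊗ z ↦ aug z • y`. [cite: MumfordAV1970, §13 Cor. 2 (p. 129), proof] -/
theorem kunneth_right_zero (haug : ∀ z : HA 0, z = aug z • oneA) (hp₂_one : p₂ 0 oneA = oneS)
    (honeS_right : ∀ (a : ℕ) (y : HS a), cupS a 0 a (by omega) y oneS = y) (a : ℕ) (h : a + 0 = a)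
    (t : HA a ⊗[k] HA 0) :
    TensorProduct.lift ((cupS a 0 a h).compl₁₂ (p₁ a) (p₂ 0)) t =
      p₁ a ((TensorProduct.rid k (HA a)).toLinearMap (TensorProduct.map LinearMap.id aug t)) := by
  induction t using TensorProduct.induction_on with
  | zero => simp
  | tmul y z =>
    rw [TensorProduct.lift.tmul, LinearMap.compl₁₂_apply, TensorProduct.map_tmul, LinearEquiv.coe_coe,
      TensorProduct.rid_tmul, LinearMap.id_apply, map_smul]
    conv_lhs => rw [haug z]
    rw [map_smul, hp₂_one, map_smul, honeS_right]
  | add s t hs ht => rw [map_add, hs, ht, map_add, map_add, map_add]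

/-- `p₁^*z ∪ p₂^*y = p₂^*(aug z • y)` for `z` of degree `0` (the `(0,b)` Künneth component).
[cite: MumfordAV1970, §13 Cor. 2 (p. 129), proof] -/
theorem kunneth_left_zero (haug : ∀ z : HA 0, z = aug z • oneA) (hp₁_one : p₁ 0 oneA = oneS)
    (honeS_left : ∀ (b : ℕ) (y : HS b), cupS 0 b b (by omega) oneS y = y) (b : ℕ) (h : 0 + b = b)
    (t : HA 0 ⊗[k] HA b) :
    TensorProduct.lift ((cupS 0 b b h).compl₁₂ (p₁ 0) (p₂ b)) t =
      p₂ b ((TensorProduct.lid k (HA b)).toLinearMap (TensorProduct.map aug LinearMap.id t)) := by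
  induction t using TensorProduct.induction_on with
  | zero => simp
  | tmul z y =>
    rw [TensorProduct.lift.tmul, LinearMap.compl₁₂_apply, TensorProduct.map_tmul, LinearEquiv.coe_coe,
      TensorProduct.lid_tmul, LinearMap.id_apply, map_smul]
    conv_lhs => rw [haug z]
    rw [map_smul, hp₁_one, map_smul, LinearMap.smul_apply, honeS_left]
  | add s t hs ht => rw [map_add, hs, ht, map_add, map_add, map_add]

/-- `Σ_{p ∈ antidiagonal 1} f p = f (0,1) + f (1,0)`. [cite: MumfordAV1970, §13 (p. 129)] -/
theorem sum_antidiagonal_one {M : Type*} [AddCommMonoid M] (f : ℕ × ℕ → M) :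
    ∑ p ∈ antidiagonal 1, f p = f (0, 1) + f (1, 0) := by
  rw [Finset.Nat.sum_antidiagonal_succ, Finset.Nat.antidiagonal_zero, Finset.sum_singleton]

/-- `Σ_{p ∈ antidiagonal 2} f p = f (0,2) + f (1,1) + f (2,0)`. [cite: MumfordAV1970, §13 (p. 129)] -/
theorem sum_antidiagonal_two {M : Type*} [AddCommMonoid M] (f : ℕ × ℕ → M) :
    ∑ p ∈ antidiagonal 2, f p = f (0, 2) + f (1, 1) + f (2, 0) := by
  rw [Finset.Nat.sum_antidiagonal_succ, sum_antidiagonal_one, add_assoc]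

/-! ### The Künneth decompositions of `m^*` in degrees `1` and `2` -/

/-- **Degree-one classes are primitive**: `m^*a = p₁^*a + p₂^*a` for `a ∈ Ȟ¹(A)` — from the degree-`1` Künneth
decomposition `Ȟ¹(A×A) = p₁^*Ȟ¹ ⊕ p₂^*Ȟ¹` (connectedness contracts the `Ȟ⁰` factors) and the slices
`i₁^* m^* = id`, `i₁^* p₁^* = id`, `i₁^* p₂^* = 0` (and symmetrically). [cite: MumfordAV1970, §13 Cor. 2 (p. 129), proof]
[cite: MilnorMoore1965, §4 Prop. 4.17 (p. 231)] -/
theorem coproduct_degree_one (haug : ∀ z : HA 0, z = aug z • oneA) (hp₁_one : p₁ 0 oneA = oneS)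
    (hp₂_one : p₂ 0 oneA = oneS) (honeS_left : ∀ (b : ℕ) (y : HS b), cupS 0 b b (by omega) oneS y = y)
    (honeS_right : ∀ (a : ℕ) (y : HS a), cupS a 0 a (by omega) y oneS = y)
    (hi₁m : ∀ (n : ℕ) (y : HA n), i₁ n (m n y) = y) (hi₂m : ∀ (n : ℕ) (y : HA n), i₂ n (m n y) = y)
    (hi₁p₁ : ∀ (n : ℕ) (y : HA n), i₁ n (p₁ n y) = y) (hi₂p₂ : ∀ (n : ℕ) (y : HA n), i₂ n (p₂ n y) = y)
    (hi₁p₂ : ∀ (n : ℕ), 1 ≤ n → ∀ (y : HA n), i₁ n (p₂ n y) = 0)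
    (hi₂p₁ : ∀ (n : ℕ), 1 ≤ n → ∀ (y : HA n), i₂ n (p₁ n y) = 0)
    (hsurj : ∀ (n : ℕ) (z : HS n), ∃ t : ∀ p : ℕ × ℕ, HA p.1 ⊗[k] HA p.2,
      z = ∑ p ∈ antidiagonal n, (if h : p.1 + p.2 = n then
        TensorProduct.lift ((cupS p.1 p.2 n h).compl₁₂ (p₁ p.1) (p₂ p.2)) (t p) else 0))
    (a : HA 1) : m 1 a = p₁ 1 a + p₂ 1 a := by
  obtain ⟨t, ht⟩ := hsurj 1 (m 1 a)
  rw [sum_antidiagonal_one] at ht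
  dsimp only at ht
  rw [dif_pos (show 0 + 1 = 1 from rfl), dif_pos (show 1 + 0 = 1 from rfl),
    kunneth_left_zero haug hp₁_one honeS_left, kunneth_right_zero haug hp₂_one honeS_right] at ht
  -- slice along `i₂` and `i₁`
  have h2 := congrArg (i₂ 1) ht
  rw [hi₂m, map_add, hi₂p₂, hi₂p₁ 1 le_rfl, add_zero] at h2
  have h1 := congrArg (i₁ 1) ht
  rw [hi₁m, map_add, hi₁p₁, hi₁p₂ 1 le_rfl, zero_add] at h1
  rw [← h1, ← h2] at ht
  rw [ht, add_comm]

/-- **Degree-two Künneth decomposition of `m^*`**: `m^*x = p₁^*x + κ(s) + p₂^*x` for some `s ∈ Ȟ¹ ⊗ Ȟ¹`, where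
`κ(a ⊗ b) = p₁^*a ∪ p₂^*b` (the outer components are identified by the multiplicative slices `i₁^*, i₂^*`, which kill
`κ(Ȟ¹ ⊗ Ȟ¹)`). [cite: MumfordAV1970, §13 Cor. 2 (p. 129), proof] [cite: MilnorMoore1965, §4 Prop. 4.17 (p. 231)] -/
theorem coproduct_degree_two (haug : ∀ z : HA 0, z = aug z • oneA) (hp₁_one : p₁ 0 oneA = oneS)
    (hp₂_one : p₂ 0 oneA = oneS) (honeS_left : ∀ (b : ℕ) (y : HS b), cupS 0 b b (by omega) oneS y = y)
    (honeS_right : ∀ (a : ℕ) (y : HS a), cupS a 0 a (by omega) y oneS = y)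
    (hi₁_mul : ∀ (a b n : ℕ) (h : a + b = n) (Y : HS a) (Z : HS b),
      i₁ n (cupS a b n h Y Z) = cupA a b n h (i₁ a Y) (i₁ b Z))
    (hi₂_mul : ∀ (a b n : ℕ) (h : a + b = n) (Y : HS a) (Z : HS b),
      i₂ n (cupS a b n h Y Z) = cupA a b n h (i₂ a Y) (i₂ b Z))
    (hi₁m : ∀ (n : ℕ) (y : HA n), i₁ n (m n y) = y) (hi₂m : ∀ (n : ℕ) (y : HA n), i₂ n (m n y) = y)
    (hi₁p₁ : ∀ (n : ℕ) (y : HA n), i₁ n (p₁ n y) = y) (hi₂p₂ : ∀ (n : ℕ) (y : HA n), i₂ n (p₂ n y) = y)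
    (hi₁p₂ : ∀ (n : ℕ), 1 ≤ n → ∀ (y : HA n), i₁ n (p₂ n y) = 0)
    (hi₂p₁ : ∀ (n : ℕ), 1 ≤ n → ∀ (y : HA n), i₂ n (p₁ n y) = 0)
    (hsurj : ∀ (n : ℕ) (z : HS n), ∃ t : ∀ p : ℕ × ℕ, HA p.1 ⊗[k] HA p.2,
      z = ∑ p ∈ antidiagonal n, (if h : p.1 + p.2 = n then
        TensorProduct.lift ((cupS p.1 p.2 n h).compl₁₂ (p₁ p.1) (p₂ p.2)) (t p) else 0))
    (x : HA 2) : ∃ s : HA 1 ⊗[k] HA 1,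
      m 2 x = p₁ 2 x + TensorProduct.lift ((cupS 1 1 2 rfl).compl₁₂ (p₁ 1) (p₂ 1)) s + p₂ 2 x := by
  obtain ⟨t, ht⟩ := hsurj 2 (m 2 x)
  rw [sum_antidiagonal_two] at ht
  dsimp only at ht
  rw [dif_pos (show 0 + 2 = 2 from rfl), dif_pos (show 1 + 1 = 2 from rfl), dif_pos (show 2 + 0 = 2 from rfl),
    kunneth_left_zero haug hp₁_one honeS_left, kunneth_right_zero haug hp₂_one honeS_right] at ht
  refine ⟨t (1, 1), ?_⟩
  -- the slices kill the middle term
  have hK1 : ∀ s : HA 1 ⊗[k] HA 1, i₁ 2 (TensorProduct.lift ((cupS 1 1 2 rfl).compl₁₂ (p₁ 1) (p₂ 1)) s) = 0 := by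
    intro s
    induction s using TensorProduct.induction_on with
    | zero => rw [map_zero, map_zero]
    | tmul y z => rw [TensorProduct.lift.tmul, LinearMap.compl₁₂_apply, hi₁_mul, hi₁p₂ 1 le_rfl, map_zero]
    | add s s' hs hs' => rw [map_add, map_add, hs, hs', add_zero]
  have hK2 : ∀ s : HA 1 ⊗[k] HA 1, i₂ 2 (TensorProduct.lift ((cupS 1 1 2 rfl).compl₁₂ (p₁ 1) (p₂ 1)) s) = 0 := by
    intro s
    induction s using TensorProduct.induction_on with
    | zero => rw [map_zero, map_zero]
    | tmul y z =>
      rw [TensorProduct.lift.tmul, LinearMap.compl₁₂_apply, hi₂_mul, hi₂p₁ 1 le_rfl, LinearMap.map_zero₂]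
    | add s s' hs hs' => rw [map_add, map_add, hs, hs', add_zero]
  have h2 := congrArg (i₂ 2) ht
  rw [hi₂m, map_add, map_add, hi₂p₂, hK2, hi₂p₁ 2 (by norm_num), add_zero, add_zero] at h2
  have h1 := congrArg (i₁ 2) ht
  rw [hi₁m, map_add, map_add, hi₁p₁, hK1, hi₁p₂ 2 (by norm_num), zero_add, zero_add] at h1
  rw [← h1, ← h2] at ht
  rw [ht]
  abel

/-- **`κ : Ȟ¹ ⊗ Ȟ¹ → Ȟ²(A × A)`, `a ⊗ b ↦ p₁^*a ∪ p₂^*b`, is injective** — the single-bidegree case of Künneth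
injectivity. [cite: MumfordAV1970, §13 Cor. 2 (p. 129), proof] -/
theorem kunneth_one_one_injective
    (hinj : ∀ (ι : Type) (s : Finset ι) (deg : ι → ℕ × ℕ) (_ : Set.InjOn deg s) (n : ℕ)
      (t : ∀ i, HA (deg i).1 ⊗[k] HA (deg i).2),
      (∑ i ∈ s, (if h : (deg i).1 + (deg i).2 = n then
        TensorProduct.lift ((cupS (deg i).1 (deg i).2 n h).compl₁₂ (p₁ (deg i).1) (p₂ (deg i).2)) (t i)
        else 0)) = 0 →
      ∀ i ∈ s, (deg i).1 + (deg i).2 = n → t i = 0) :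
    Function.Injective (TensorProduct.lift ((cupS 1 1 2 rfl).compl₁₂ (p₁ 1) (p₂ 1))) := by
  rw [injective_iff_map_eq_zero]
  intro s hs
  have h := hinj Unit {()} (fun _ => (1, 1)) (Set.injOn_of_injective (fun _ _ _ => rfl)) 2 (fun _ => s) (by
    rw [Finset.sum_singleton]
    dsimp only
    rw [dif_pos (show 1 + 1 = 2 from rfl)]
    exact hs) () (Finset.mem_singleton_self _) rfl
  exact h

/-! ### The assembly -/

/-- **`Ȟ¹ ∪ Ȟ¹ = Ȟ²` (cup product onto in degree two)** for a connected, bounded, graded-commutative bialgebra given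
by PIECES with a Künneth decomposition, over a field of characteristic `0` — the degree-two case of the Hopf–Borel ∕
Milnor–Moore structure theorem as used for abelian varieties («`H²(A, 𝒪_A) = Λ² H¹(A, 𝒪_A)`»).  Hypotheses: see the
module docstring (multiplicativity and unitality of `m, p₁, p₂, sw, i₁, i₂`; slice and swap composites; associativity
and graded commutativity of `HS`; Künneth injectivity ∕ surjectivity; connectedness `aug`; boundedness).
[cite: MumfordAV1970, §13 Cor. 2 (p. 129)] [cite: MilnorMoore1965, §4 Prop. 4.17, Prop. 4.20 (pp. 231–232)] -/
theorem cup_one_one_surjective [CharZero k]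
    (haug : ∀ z : HA 0, z = aug z • oneA) (hp₁_one : p₁ 0 oneA = oneS) (hp₂_one : p₂ 0 oneA = oneS)
    (hm_one : m 0 oneA = oneS)
    (honeA_left : ∀ (b : ℕ) (y : HA b), cupA 0 b b (by omega) oneA y = y)
    (honeA_right : ∀ (a : ℕ) (y : HA a), cupA a 0 a (by omega) y oneA = y)
    (honeS_left : ∀ (b : ℕ) (y : HS b), cupS 0 b b (by omega) oneS y = y)
    (honeS_right : ∀ (a : ℕ) (y : HS a), cupS a 0 a (by omega) y oneS = y)
    (hm_mul : ∀ (a b n : ℕ) (h : a + b = n) (y : HA a) (z : HA b),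
      m n (cupA a b n h y z) = cupS a b n h (m a y) (m b z))
    (hp₁_mul : ∀ (a b n : ℕ) (h : a + b = n) (y : HA a) (z : HA b),
      p₁ n (cupA a b n h y z) = cupS a b n h (p₁ a y) (p₁ b z))
    (hp₂_mul : ∀ (a b n : ℕ) (h : a + b = n) (y : HA a) (z : HA b),
      p₂ n (cupA a b n h y z) = cupS a b n h (p₂ a y) (p₂ b z))
    (hsw_mul : ∀ (a b n : ℕ) (h : a + b = n) (Y : HS a) (Z : HS b),
      sw n (cupS a b n h Y Z) = cupS a b n h (sw a Y) (sw b Z))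
    (hi₁_mul : ∀ (a b n : ℕ) (h : a + b = n) (Y : HS a) (Z : HS b),
      i₁ n (cupS a b n h Y Z) = cupA a b n h (i₁ a Y) (i₁ b Z))
    (hi₂_mul : ∀ (a b n : ℕ) (h : a + b = n) (Y : HS a) (Z : HS b),
      i₂ n (cupS a b n h Y Z) = cupA a b n h (i₂ a Y) (i₂ b Z))
    (hi₁m : ∀ (n : ℕ) (y : HA n), i₁ n (m n y) = y) (hi₂m : ∀ (n : ℕ) (y : HA n), i₂ n (m n y) = y)
    (hi₁p₁ : ∀ (n : ℕ) (y : HA n), i₁ n (p₁ n y) = y) (hi₂p₂ : ∀ (n : ℕ) (y : HA n), i₂ n (p₂ n y) = y)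
    (hi₁p₂ : ∀ (n : ℕ), 1 ≤ n → ∀ (y : HA n), i₁ n (p₂ n y) = 0)
    (hi₂p₁ : ∀ (n : ℕ), 1 ≤ n → ∀ (y : HA n), i₂ n (p₁ n y) = 0)
    (hswm : ∀ (n : ℕ) (y : HA n), sw n (m n y) = m n y)
    (hswp₁ : ∀ (n : ℕ) (y : HA n), sw n (p₁ n y) = p₂ n y)
    (hswp₂ : ∀ (n : ℕ) (y : HA n), sw n (p₂ n y) = p₁ n y)
    (hassoc : ∀ (a b c ab bc n : ℕ) (hab : a + b = ab) (hbc : b + c = bc) (h : ab + c = n)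
      (y : HS a) (z : HS b) (w : HS c),
      cupS ab c n h (cupS a b ab hab y z) w = cupS a bc n (by omega) y (cupS b c bc hbc z w))
    (hcomm : ∀ (a b n : ℕ) (h : a + b = n) (y : HS a) (z : HS b),
      cupS a b n h y z = ((-1 : k) ^ (a * b)) • cupS b a n (by omega) z y)
    (hinj : ∀ (ι : Type) (s : Finset ι) (deg : ι → ℕ × ℕ) (_ : Set.InjOn deg s) (n : ℕ)
      (t : ∀ i, HA (deg i).1 ⊗[k] HA (deg i).2),
      (∑ i ∈ s, (if h : (deg i).1 + (deg i).2 = n then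
        TensorProduct.lift ((cupS (deg i).1 (deg i).2 n h).compl₁₂ (p₁ (deg i).1) (p₂ (deg i).2)) (t i)
        else 0)) = 0 →
      ∀ i ∈ s, (deg i).1 + (deg i).2 = n → t i = 0)
    (hsurj : ∀ (n : ℕ) (z : HS n), ∃ t : ∀ p : ℕ × ℕ, HA p.1 ⊗[k] HA p.2,
      z = ∑ p ∈ antidiagonal n, (if h : p.1 + p.2 = n then
        TensorProduct.lift ((cupS p.1 p.2 n h).compl₁₂ (p₁ p.1) (p₂ p.2)) (t p) else 0))
    (hbound : ∃ N : ℕ, ∀ n : ℕ, N ≤ n → ∀ y : HA n, y = 0) :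
    Function.Surjective (TensorProduct.lift (cupA 1 1 2 rfl)) := by
  classical
  -- the Künneth pairing in bidegree `(1,1)` and the reduced coproduct `μ`
  set K : HA 1 ⊗[k] HA 1 →ₗ[k] HS 2 := TensorProduct.lift ((cupS 1 1 2 rfl).compl₁₂ (p₁ 1) (p₂ 1)) with hKdef
  have hKinj : Function.Injective K := kunneth_one_one_injective hinj
  have hK_tmul : ∀ a b : HA 1, K (a ⊗ₜ b) = cupS 1 1 2 rfl (p₁ 1 a) (p₂ 1 b) := fun a b => by
    rw [hKdef, TensorProduct.lift.tmul, LinearMap.compl₁₂_apply]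
  set g : HA 2 →ₗ[k] HS 2 := m 2 - p₁ 2 - p₂ 2 with hgdef
  have hg : ∀ x : HA 2, g x ∈ LinearMap.range K := by
    intro x
    obtain ⟨s, hs⟩ := coproduct_degree_two haug hp₁_one hp₂_one honeS_left honeS_right hi₁_mul hi₂_mul hi₁m hi₂m
      hi₁p₁ hi₂p₂ hi₁p₂ hi₂p₁ hsurj x
    refine ⟨s, ?_⟩
    rw [hgdef, LinearMap.sub_apply, LinearMap.sub_apply, hs]
    abel
  let μ : HA 2 →ₗ[k] HA 1 ⊗[k] HA 1 :=
    (LinearEquiv.ofInjective K hKinj).symm.toLinearMap ∘ₗ g.codRestrict (LinearMap.range K) hg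
  have hKμ : ∀ x : HA 2, K (μ x) = m 2 x - p₁ 2 x - p₂ 2 x := by
    intro x
    show K ((LinearEquiv.ofInjective K hKinj).symm (g.codRestrict (LinearMap.range K) hg x)) = _
    rw [LinearEquiv.ofInjective_symm_apply]
    rfl
  have hΔ : ∀ x : HA 2, m 2 x = p₁ 2 x + K (μ x) + p₂ 2 x := by
    intro x
    rw [hKμ]
    abel
  -- degree-one classes are primitive
  have hdeg1 : ∀ a : HA 1, m 1 a = p₁ 1 a + p₂ 1 a :=
    coproduct_degree_one haug hp₁_one hp₂_one honeS_left honeS_right hi₁m hi₂m hi₁p₁ hi₂p₂ hi₁p₂ hi₂p₁ hsurj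
  -- (h1) `μ (a ∪ b) = a ⊗ b - b ⊗ a`
  have h1 : ∀ a b : HA 1, μ (TensorProduct.lift (cupA 1 1 2 rfl) (a ⊗ₜ b)) = a ⊗ₜ b - b ⊗ₜ a := by
    intro a b
    apply hKinj
    rw [hKμ, TensorProduct.lift.tmul, hm_mul, hp₁_mul, hp₂_mul, hdeg1, hdeg1]
    simp only [map_add, map_sub, LinearMap.add_apply, hK_tmul]
    rw [hcomm 1 1 2 rfl (p₂ 1 a) (p₁ 1 b), pow_one, neg_one_smul]
    abel
  -- (h2) `μ x` is antisymmetric, from `sw ∘ m = m`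
  have hσκ : ∀ t : HA 1 ⊗[k] HA 1, sw 2 (K t) = -K (TensorProduct.comm k (HA 1) (HA 1) t) := by
    intro t
    induction t using TensorProduct.induction_on with
    | zero => simp
    | tmul a b =>
      rw [TensorProduct.comm_tmul, hK_tmul, hK_tmul, hsw_mul, hswp₁, hswp₂, hcomm 1 1 2 rfl (p₂ 1 a) (p₁ 1 b),
        pow_one, neg_one_smul]
    | add s s' hs hs' => rw [map_add, map_add, hs, hs', map_add, map_add, neg_add]
  have h2 : ∀ x : HA 2, TensorProduct.comm k (HA 1) (HA 1) (μ x) = -μ x :=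
    comm_reducedCoproduct_eq_neg (m 2) (p₁ 2) (p₂ 2) K μ (sw 2) hΔ hKinj (hswm 2) (hswp₁ 2) (hswp₂ 2) hσκ
  -- (h3) no primitives in degree two: the power argument on the even pieces `HA (2i)`, `HS (2i)`
  have hprim : ∀ x : HA 2, m 2 x = p₁ 2 x + p₂ 2 x → x = 0 := by
    intro x hx
    obtain ⟨N, hN⟩ := hbound
    refine eq_zero_of_primitive_of_bounded (k := k) (H := fun i => HA (2 * i)) (S := fun i => HS (2 * i))
      (fun a b n h => cupA (2 * a) (2 * b) (2 * n) (by omega))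
      (fun a b n h => cupS (2 * a) (2 * b) (2 * n) (by omega))
      (fun a b n h => (cupS (2 * a) (2 * b) (2 * n) (by omega)).compl₁₂ (p₁ (2 * a)) (p₂ (2 * b)))
      (fun n => m (2 * n)) oneA ?_ ?_ ?_ ?_ ?_ ?_ ⟨N, fun y => hN (2 * N) (by omega) y⟩ ?_
    · -- `m` multiplicative
      intro a b n h y z
      exact hm_mul _ _ _ _ y z
    · -- `κ` multiplicative (interchange with even middle degrees)
      intro a b n h a' b' n' h' N' hN' A hA B hB y z y' z'
      simp only [LinearMap.compl₁₂_apply]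
      rw [hp₁_mul, hp₂_mul]
      exact cup_interchange_of_even hassoc hcomm (2 * a) (2 * b) (2 * a') (2 * b') (2 * n) (2 * n') (2 * N')
        (2 * A) (2 * B) (by omega) (by omega) (by omega) (by omega) (by omega) ⟨b * (2 * a'), by ring⟩ _ _ _ _
    · -- left unit
      intro a y
      exact honeA_left (2 * a) y
    · -- right unit
      intro a y
      exact honeA_right (2 * a) y
    · -- `m 1 = κ(1 ⊗ 1)`
      show m 0 oneA = cupS 0 0 0 _ (p₁ 0 oneA) (p₂ 0 oneA)
      rw [hm_one, hp₁_one, hp₂_one, honeS_left]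
    · -- Künneth injectivity on the even bidegrees
      intro n t ht p hp
      have hpn : p.1 + p.2 = n := Finset.HasAntidiagonal.mem_antidiagonal.mp hp
      refine hinj (ℕ × ℕ) (antidiagonal n) (fun q => (2 * q.1, 2 * q.2)) ?_ (2 * n) t ?_ p hp (by
        show 2 * p.1 + 2 * p.2 = 2 * n; omega)
      · intro q _ q' _ hqq'
        simp only [Prod.mk.injEq] at hqq'
        exact Prod.ext (by omega) (by omega)
      · rw [← ht]
        refine Finset.sum_congr rfl fun q hq => ?_
        have hqn : q.1 + q.2 = n := Finset.HasAntidiagonal.mem_antidiagonal.mp hq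
        simp only
        rw [dif_pos (show 2 * q.1 + 2 * q.2 = 2 * n by omega), dif_pos hqn]
    · -- `x` is primitive
      show m 2 x = cupS 2 0 2 _ (p₁ 2 x) (p₂ 0 oneA) + cupS 0 2 2 _ (p₁ 0 oneA) (p₂ 2 x)
      rw [hp₂_one, hp₁_one, honeS_right, honeS_left]
      exact hx
  have h3 : ∀ x : HA 2, μ x = 0 → x = 0 := reducedCoproduct_eq_zero_imp (m 2) (p₁ 2) (p₂ 2) K μ hΔ hprim
  haveI : Invertible (2 : k) := invertibleOfNonzero two_ne_zero
  exact cup_surjective (TensorProduct.lift (cupA 1 1 2 rfl)) μ h1 h2 h3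

end Assembly

end Literature.Algebra.Bialgebra
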